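import Literature.AlgebraicGeometry.HodgeTheory.ThetaTraceTimesCMProductSpan
import Literature.AlgebraicGeometry.HodgeTheory.RibetTypeOnePowersHodgeClasses
import Literature.AlgebraicGeometry.Motives.HodgeThetaAnnihilatorTimesRankOneTorus
import HarnessLib

/-!
# The invariance theorem for `A × E`: `A` with imaginary quadratic `End⁰(A) = ℚ(√-d)`, `E` an elliptic curve with complex multiplication by `ℚ(√-d')`, `d/d' ∉ (ℚ^×)²` (Moonen–Zarhin 1999 Lemma (3.6) / Prop. (3.8): «either `Hg(X × E) = Hg(X) × Hg(E)` or `End⁰(E) = k` … embeds into the center of `End⁰(X)`»)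

Family `hodge`, layer `Literature/AlgebraicGeometry/HodgeTheory`. Research context: cell `pub-hodge-ring2` (HONEST
FRAMING: research route conditional on HC_CM; not a corollary; Q11.4-sentence-2 already refuted in dim ≥ 3),
Literature lane, programme R24 «`E_k × T`, `T` a simple abelian threefold of type IV(1,1) NOT of CM type,
`k ≇ End⁰(T)`» — the last `E × T` row of Moonen–Zarhin's Thm. 0.1 (4) — geometric half, the sequel of the abstract
Lie step `Motives/HodgeThetaAnnihilatorTimesRankOneTorus`. UNCONDITIONAL; theorems only (no definition, no named
fact, D-0026; nothing admitted); no step towards a summit statement beyond the printed results it formalizes.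

PRINTED RESULTS. B. Moonen, Yu. Zarhin, *Hodge classes on abelian varieties of low dimension*, Math. Ann. 315
(1999) [held: `paper:arxiv-math_9901113`]: §3 (3.1) (p. 6) «`𝔤₃ ≠ 0` … if and only if for some `m` and `n` the Hodge
ring `B(X₁^m × X₂^n)` is not generated by the elements coming from `B(X₁^m)` and `B(X₂^n)`»; Lemma (3.6) (p. 7)
«Assume that the Hodge group `Hg(X₂)` is a `ℚ`-simple algebraic torus … If `Hg(X) ≠ Hg(X₁) × Hg(X₂)` then the
center of `Hg(X₁)` contains an algebraic torus which is `ℚ`-isogenous to `Hg(X₂)`»; Prop. (3.8) (p. 7) «Let `X` be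
an abelian variety and let `E` be an elliptic curve, both over `ℂ`. Suppose `Hom(E,X) = 0`. Then either
`Hg(X × E) = Hg(X) × Hg(E)` or `End⁰(E) = k` is an imaginary quadratic field such that there exists an embedding of
`k` into the center of `End⁰(X)`»; (2.3) (p. 5) type IV(1,1): «`End⁰(X) = F` is an imaginary quadratic field … `F`
necessarily acts on the tangent space with multiplicities `(2,1)` … `Hg(X) = U_F(V,ψ)`»; Thm. 0.1 (4) with case (a)
(p. 1).

THIS FILE. §1 the `Θ`-trace of `φ^*` on `H¹(A(ℂ); ℚ) ⊗ ℂ` for `φ ∈ End(A)` with `φ ≫ φ = -d`: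
`tr(Θ_A ∘ φ^*_ℂ) = 2i√d·(n_{i√d} - n_{-i√d})` (`trace_theta_mul_baseChange_pullback_eq`; `n_ρ = eigenMultiplicity A φ ρ`
the multiplicity on `H^{1,0}`; from the abstract `trace_theta_mul_baseChange_eq_of_sq_eq_neg` and the tree's
`finrank_eigenspace_inf_piece_{oneZero,zeroOne}_eq_eigenMultiplicity{,_conj}`) and `tr((φ^*)²) = -2d·dim A`.
§2 the data of the abstract Lie step: for `dim_ℚ End⁰(A) = 2` and `φ ≫ φ = -d`, `φ^*` is a `ψ`-skew Hodge
endomorphism and every `ψ`-skew (central) Hodge endomorphism of `H¹(A; ℚ)` is a rational multiple of `φ^*`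
(`quadraticEnd_skewCentre_data`: `End_Hdg(H¹) = ℚ + ℚφ^*` by Riemann, `exists_eq_smul_one_add_smul_bettiMapHom`;
Rosati = complex conjugation on `ℚ(φ)`, `UnitaryTheta.form_apply_add_form_apply_eq_zero`; `ψ ≠ 0`); and the RATIONAL
INDEPENDENCE OF THE `Θ`-TRACE SLOPES (`traceSlopes_ne_of_forall_ne_sq_mul`): if `d ≠ q²d'` for all rational `q`
then `tr((φ^*)²)·tr(Θ_E χ^*_ℂ) ≠ c·tr(Θ_A φ^*_ℂ)·tr((χ^*)²)` for all rational `c` (`E` an elliptic curve with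
`χ ≫ χ = -d'`; squaring `(-2d·dim A)·(±2i√d') = c·2i√d(n-n')·(-2d')` gives `d·(dim A)² = (c(n-n'))²·d'`, i.e.
`d = q²d'`). §3 **`AVSlots.exists_coeff_eq_zero_off_balanced_of_prod_quadraticEnd_cmCurve`** — the INVARIANCE THEOREM
for slots over `A × E`: `0 < dim A`, `dim_ℚ End⁰(A) = 2`, `φ ≫ φ = -d` (any multiplicities), `dim E = 1`,
`χ ≫ χ = -d'`, `∀ q : ℚ, d ≠ q²d'` ⟹ every rational `(p,p)`-class on `X` with slots over `A × E` has a letter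
expansion vanishing off the `A`-kind-balanced words (the tree's `ThetaTraceTimesCMProductSpan` §4 verbatim with the
Lie step `wordDerAt_incl_theta_proj_eq_zero_of_rankOneCentre_times_cmCurve`). For BALANCED multiplicities the
`Θ`-trace condition holds and the tree's theorem applies without `hfree`; the present theorem is the UNBALANCED
complement («residual (r1)» of `ThetaTraceTimesCMProductSpan`), e.g. `A = T` a simple abelian threefold of type
IV(1,1) (multiplicities `(2,1)`, (2.3)) or a simple fourfold with multiplicities `(3,1)` (Thm. 0.2 case (g) excluded
by `k ≇ ℚ(√-d)`). The product span, condition (D) and the `E × T` row of Thm. 0.1 (4) are drawn in the sequel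
`RankOneCentreTimesCMCurveProductSpan`.

## References

* [MoonenZarhin1999LowDim] B. Moonen, Yu. Zarhin, Math. Ann. 315 (1999), §3 (3.1), Lemma (3.6), Prop. (3.8), §2
  (2.3), Thm. 0.1 (4) with (a) (held `paper:arxiv-math_9901113` pp. 1, 5–7). [cite: MoonenZarhin1999LowDim, §3 Lemma (3.6) and Prop. (3.8)]
* [Deligne1982HodgeCycles] P. Deligne, LNM 900 (1982), I §3 Prop. 3.4, Prop. 3.6; §4 p. 30. [cite: Deligne1982HodgeCycles, I §3 Prop. 3.6]
* [Lombardo2016] D. Lombardo, Ann. Inst. Fourier 66 (2016), Lemma 3.4 (p. 1229). [cite: Lombardo2016, Lemma 3.4 (p. 1229)]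
* [DeligneMilne1982Tannakian] P. Deligne, J. S. Milne, LNM 900 (1982), §6 Thm. 6.20 (Riemann for `End`). [cite: DeligneMilne1982Tannakian, §6 Thm. 6.20]
* [Gordon1997] B. B. Gordon, App. B of Lewis (1999) = arXiv:alg-geom/9709030, 1.13.2, Thm. 6.3 (3). [cite: Gordon1997, Thm. 6.3 (3)]
* [VoisinHodgeI2002] C. Voisin, *Hodge Theory I*, §7.1.1. [cite: VoisinHodgeI2002, §7.1.1]
* [MumfordAV1970] D. Mumford, *Abelian Varieties*, §21 (Rosati positivity). [cite: MumfordAV1970, §21]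
-/

noncomputable section

open scoped TensorProduct
open CategoryTheory Module

namespace Literature.AlgebraicGeometry.HodgeTheory

open Literature.AlgebraicTopology.SingularHomology
open Literature.AlgebraicGeometry.Motives (IsSmoothProjective AbelianVariety bettiCohomology
  ofRatClassBaseChange ofRatClassBaseChange_tmul HodgeTensorFacts hodgeTensorFacts_holds ComplexPoints)
open Literature.Barriers.HodgeConjecture
open Literature.AlgebraicGeometry.Motives.HodgeStructure
open Literature.AlgebraicGeometry.ComplexMultiplication
open Literature.RepresentationTheory.GeneralLinear
open Literature.NumberTheory.DiophantineGeometry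

/-! ### §1 The `Θ`-trace of `φ^*` for `φ ≫ φ = -d` -/

section ThetaTrace

variable {A : AbelianVariety ℂ}

/-- `(i√d)² = -d` (as the rational `d` cast to `ℂ`). [folklore] -/
private theorem I_mul_sqrt_sq_rk (d : ℕ) : (Complex.I * (Real.sqrt d : ℂ)) ^ 2 = -((d : ℚ) : ℂ) := by
  rw [mul_pow, Complex.I_sq, ← Complex.ofReal_pow, Real.sq_sqrt (Nat.cast_nonneg d), Complex.ofReal_natCast,
    Rat.cast_natCast, neg_one_mul]

/-- `conj(i√d) = -i√d`. [folklore] -/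
private theorem conj_I_mul_sqrt_rk (d : ℕ) :
    starRingEnd ℂ (Complex.I * (Real.sqrt d : ℂ)) = -(Complex.I * (Real.sqrt d : ℂ)) := by
  rw [map_mul, Complex.conj_I, Complex.conj_ofReal, neg_mul]

/-- `φ^*_ℚ ∈ End_Hdg(H¹(A(ℂ); ℚ))` (pull-backs are morphisms of Hodge structures; Riemann's `bettiRep`).
[cite: DeligneMilne1982Tannakian, §6 Thm. 6.20] -/
theorem pullback_mem_endAlg (hHD : exists_isReal_hodgeModel) (hI : hodgePQ_independent_of_hodgeModel)
    (φ : A ⟶ A) :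
    (bettiCohomology.map φ.hom.hom.hom 1).hom ∈
      (BettiUniverse.hodge hHD (AbelianVariety.isSmoothProjective_holds (A := A)) 1).endAlg := by
  have h := unop_bettiRep_mem_endAlg hHD hI (AbelianVariety.endAlgebra.of A φ)
  rwa [bettiRep_of, MulOpposite.unop_op] at h

/-- **`tr(Θ_A ∘ φ^*_ℂ) = 2i√d·(n_{i√d} - n_{-i√d})`** on `H¹(A(ℂ); ℚ) ⊗ ℂ`, for `φ ∈ End(A)` with `φ ≫ φ = -d`,
`d > 0`, `Θ_A` the Hodge grading operator and `n_ρ = eigenMultiplicity A φ ρ` the multiplicity of `ρ` on `H^{1,0}(A)`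
(the abstract `trace_theta_mul_baseChange_eq_of_sq_eq_neg` with `n⁰¹_ρ = n_{ρ̄}`, Gordon 1.13.2). It vanishes iff the
multiplicities are balanced (Moonen–Zarhin's criterion). [cite: MoonenZarhin1999LowDim, §2 (2.3)]
[cite: Gordon1997, 1.13.2] [cite: MoonenZarhin1998WeilClasses, §1 Remark (1) after Criterion (2)] -/
theorem trace_theta_mul_baseChange_pullback_eq (hHD : exists_isReal_hodgeModel)
    (hI : hodgePQ_independent_of_hodgeModel) (φ : A ⟶ A) {d : ℕ} (hd : 0 < d) (hφ : φ ≫ φ = -(d • 𝟙 A))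
    {Θ : Module.End ℂ (ℂ ⊗[ℚ] bettiCohomology A.X 1)}
    (hΘ : ∀ p, ∀ x ∈ (BettiUniverse.hodge hHD (AbelianVariety.isSmoothProjective_holds (A := A)) 1).piece p
      (((1 : ℕ) : ℤ) - p), Θ x = ((2 * p - ((1 : ℕ) : ℤ) : ℤ) : ℂ) • x) :
    LinearMap.trace ℂ _ (Θ * (bettiCohomology.map φ.hom.hom.hom 1).hom.baseChange ℂ) =
      2 * (Complex.I * (Real.sqrt d : ℂ)) *
        ((eigenMultiplicity A φ (Complex.I * (Real.sqrt d : ℂ)) : ℂ) -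
          (eigenMultiplicity A φ (-(Complex.I * (Real.sqrt d : ℂ))) : ℂ)) := by
  haveI : HodgeTensorFacts.{0, 0} := hodgeTensorFacts_holds.{0, 0}
  haveI : Module.Finite ℚ (bettiCohomology A.X 1) := finite_bettiCohomology_one A
  have hX : IsSmoothProjective A.dim A.X := AbelianVariety.isSmoothProjective_holds
  set φQ : Module.End ℚ (bettiCohomology A.X 1) := (bettiCohomology.map φ.hom.hom.hom 1).hom with hφQ
  have hφE : φQ ∈ (BettiUniverse.hodge hHD hX 1).endAlg := pullback_mem_endAlg hHD hI φ
  have hφ2 : φQ * φQ = -((d : ℚ) • 1) := bettiMapHom_mul_self hφ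
  have hdQ : (0 : ℚ) < d := Nat.cast_pos.2 hd
  set μ : ℂ := Complex.I * (Real.sqrt d : ℂ) with hμdef
  have hμ : μ ^ 2 = -((d : ℚ) : ℂ) := I_mul_sqrt_sq_rk d
  have hconj : starRingEnd ℂ μ = -μ := conj_I_mul_sqrt_rk d
  have hconj' : starRingEnd ℂ (-μ) = μ := by rw [map_neg, hconj, neg_neg]
  have h := trace_theta_mul_baseChange_eq_of_sq_eq_neg (BettiUniverse.hodge hHD hX 1) (Nat.cast_one)
    (BettiUniverse.hodge_isEffective hHD hX 1) hφE hdQ hφ2 hμ hΘ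
  rw [h, hφQ, finrank_eigenspace_inf_piece_oneZero_eq_eigenMultiplicity hHD hI φ μ,
    finrank_eigenspace_inf_piece_zeroOne_eq_eigenMultiplicity_conj hHD hI φ μ,
    finrank_eigenspace_inf_piece_oneZero_eq_eigenMultiplicity hHD hI φ (-μ),
    finrank_eigenspace_inf_piece_zeroOne_eq_eigenMultiplicity_conj hHD hI φ (-μ), hconj, hconj']
  ring

/-- `tr((φ^*_ℚ)²) = -2d·dim A` for `φ ≫ φ = -d` (`dim_ℚ H¹(A(ℂ); ℚ) = 2 dim A`). [cite: MumfordAV1970, §21]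
[cite: MoonenZarhin1999LowDim, §2 (2.3)] -/
theorem trace_pullback_mul_self_eq (φ : A ⟶ A) {d : ℕ} (hφ : φ ≫ φ = -(d • 𝟙 A)) :
    LinearMap.trace ℚ _ ((bettiCohomology.map φ.hom.hom.hom 1).hom * (bettiCohomology.map φ.hom.hom.hom 1).hom) =
      -((d : ℚ) * (2 * A.dim)) := by
  haveI : Module.Finite ℚ (bettiCohomology A.X 1) := finite_bettiCohomology_one A
  rw [trace_mul_self_eq_of_sq_eq_neg (bettiMapHom_mul_self hφ), finrank_bettiCohomology_one A]
  push_cast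
  ring

end ThetaTrace

/-! ### §2 The data of the Lie step: skew centre `ℚφ^*`, and the rational independence of the `Θ`-trace slopes -/

section Data

variable {A C : AbelianVariety ℂ}

/-- **For `dim_ℚ End⁰(A) = 2` and `φ ≫ φ = -d` (`d > 0`): `φ^*` is a Hodge endomorphism with `(φ^*)² = -d`, and
every `ψ`-skew central Hodge endomorphism of `H¹(A(ℂ); ℚ)` is a rational multiple of `φ^*`** — `End_Hdg(H¹) = ℚ + ℚφ^*`
(Riemann; `exists_eq_smul_one_add_smul_bettiMapHom`), `φ^*` is `ψ`-skew (the Rosati involution is complex conjugation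
on `ℚ(φ)`, `UnitaryTheta.form_apply_add_form_apply_eq_zero`), and `ψ ≠ 0`, so a skew `x + yφ^*` has `x = 0`. («The
centre of `Hg(X)` is contained in `U_F`», `F = ℚ(φ)` the centre of `End⁰(X)`.) [cite: MoonenZarhin1999LowDim, §2 (2.3) and §3 Prop. (3.8) (proof)]
[cite: Gordon1997, Thm. 6.3 (3)] [cite: MumfordAV1970, §21] -/
theorem quadraticEnd_skewCentre_data (hHD : exists_isReal_hodgeModel) (hI : hodgePQ_independent_of_hodgeModel)
    (hA0 : 0 < A.dim) (hA2 : Module.finrank ℚ A.endAlgebra = 2) {φ : A ⟶ A} {d : ℕ} (hd : 0 < d)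
    (hφ : φ ≫ φ = -(d • 𝟙 A))
    (ψ : (BettiUniverse.hodge hHD (AbelianVariety.isSmoothProjective_holds (A := A)) 1).Polarization) :
    (bettiCohomology.map φ.hom.hom.hom 1).hom ∈
        (BettiUniverse.hodge hHD (AbelianVariety.isSmoothProjective_holds (A := A)) 1).endAlg ∧
      (bettiCohomology.map φ.hom.hom.hom 1).hom * (bettiCohomology.map φ.hom.hom.hom 1).hom = -((d : ℚ) • 1) ∧
      ∀ a ∈ (BettiUniverse.hodge hHD (AbelianVariety.isSmoothProjective_holds (A := A)) 1).endAlg,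
        (∀ b ∈ (BettiUniverse.hodge hHD (AbelianVariety.isSmoothProjective_holds (A := A)) 1).endAlg,
          a * b = b * a) →
        (∀ v w, ψ.form (a v) w + ψ.form v (a w) = 0) →
        ∃ x : ℚ, a = x • (bettiCohomology.map φ.hom.hom.hom 1).hom := by
  classical
  haveI : Module.Finite ℚ (bettiCohomology A.X 1) := finite_bettiCohomology_one A
  haveI : Nontrivial (bettiCohomology A.X 1) := by
    apply Module.nontrivial_of_finrank_pos (R := ℚ)
    rw [finrank_bettiCohomology_one A]
    omega
  have hX : IsSmoothProjective A.dim A.X := AbelianVariety.isSmoothProjective_holds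
  set φQ : Module.End ℚ (bettiCohomology A.X 1) := (bettiCohomology.map φ.hom.hom.hom 1).hom with hφQ
  have hφE : φQ ∈ (BettiUniverse.hodge hHD hX 1).endAlg := pullback_mem_endAlg hHD hI φ
  have hφ2 : φQ * φQ = -((d : ℚ) • 1) := bettiMapHom_mul_self hφ
  have hdQ : (0 : ℚ) < d := Nat.cast_pos.2 hd
  have hE := exists_eq_smul_one_add_smul_bettiMapHom hHD hI hd hφ hA2 hA0
  have hφskew : ∀ v w, ψ.form (φQ v) w + ψ.form v (φQ w) = 0 :=
    UnitaryTheta.form_apply_add_form_apply_eq_zero _ ψ hφE hdQ hφ2 hE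
  refine ⟨hφE, hφ2, fun a ha _ hskew => ?_⟩
  obtain ⟨x, y, rfl⟩ := hE a ha
  -- the scalar part of a skew endomorphism vanishes: `2x ψ(v,w) = 0` for all `v, w`
  obtain ⟨v, hv⟩ := exists_ne (0 : bettiCohomology A.X 1)
  obtain ⟨w, hvw⟩ : ∃ w, ψ.form v w ≠ 0 := by
    by_contra! h
    exact hv (ψ.nondegenerate.1 v h)
  have h := hskew v w
  simp only [LinearMap.add_apply, LinearMap.smul_apply, Module.End.one_apply, map_add, map_smul, smul_eq_mul] at h
  have hy := hφskew v w
  have hx : (2 * x) * ψ.form v w = 0 := by linear_combination h - y * hy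
  have hx0 : x = 0 := by
    rcases mul_eq_zero.1 hx with h2 | h2
    · linarith [h2]
    · exact absurd h2 hvw
  refine ⟨y, ?_⟩
  rw [hx0, zero_smul, zero_add]

/-- **Rational independence of the `Θ`-trace slopes from `d ≠ q² d'`.** For `φ ∈ End(A)` with `φ ≫ φ = -d`
(`dim A > 0`) and an elliptic curve `E` with `χ ≫ χ = -d'`: if `d ≠ q² d'` for every rational `q` (i.e.
`ℚ(√-d') ≇ ℚ(√-d)`: «no embedding of `k` into the center of `End⁰(X)`», Prop. (3.8)), then
`tr((φ^*)²)·tr(Θ_E χ^*_ℂ) ≠ c·tr(Θ_A φ^*_ℂ)·tr((χ^*)²)` for every rational `c` — the hypothesis (NONRES) of the abstract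
Lie step. (By §1 the traces are `-2d·dim A`, `±2i√d'`, `2i√d(n - n')`, `-2d'`; equality for some `c` squares to
`d·(dim A)² = c²(n - n')²·d'`.) [cite: MoonenZarhin1999LowDim, §3 Prop. (3.8)] [cite: MoonenZarhin1999LowDim, §2 (2.1) and (2.3)] -/
theorem traceSlopes_ne_of_forall_ne_sq_mul (hHD : exists_isReal_hodgeModel) (hI : hodgePQ_independent_of_hodgeModel)
    (hA0 : 0 < A.dim) {φ : A ⟶ A} {d : ℕ} (hd : 0 < d) (hφ : φ ≫ φ = -(d • 𝟙 A)) (hC1 : C.dim = 1)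
    {χ : C ⟶ C} {d' : ℕ} (hd' : 0 < d') (hχ : χ ≫ χ = -(d' • 𝟙 C)) (hfree : ∀ q : ℚ, (d : ℚ) ≠ q ^ 2 * d')
    {ΘA : Module.End ℂ (ℂ ⊗[ℚ] bettiCohomology A.X 1)}
    (hΘA : ∀ p, ∀ x ∈ (BettiUniverse.hodge hHD (AbelianVariety.isSmoothProjective_holds (A := A)) 1).piece p
      (((1 : ℕ) : ℤ) - p), ΘA x = ((2 * p - ((1 : ℕ) : ℤ) : ℤ) : ℂ) • x)
    {ΘC : Module.End ℂ (ℂ ⊗[ℚ] bettiCohomology C.X 1)}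
    (hΘC : ∀ p, ∀ x ∈ (BettiUniverse.hodge hHD (AbelianVariety.isSmoothProjective_holds (A := C)) 1).piece p
      (((1 : ℕ) : ℤ) - p), ΘC x = ((2 * p - ((1 : ℕ) : ℤ) : ℤ) : ℂ) • x) :
    ∀ c : ℚ, ((LinearMap.trace ℚ _ ((bettiCohomology.map φ.hom.hom.hom 1).hom *
        (bettiCohomology.map φ.hom.hom.hom 1).hom) : ℚ) : ℂ) *
        LinearMap.trace ℂ _ (ΘC * (bettiCohomology.map χ.hom.hom.hom 1).hom.baseChange ℂ) ≠
      (c : ℂ) * (LinearMap.trace ℂ _ (ΘA * (bettiCohomology.map φ.hom.hom.hom 1).hom.baseChange ℂ) *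
        ((LinearMap.trace ℚ _ ((bettiCohomology.map χ.hom.hom.hom 1).hom *
          (bettiCohomology.map χ.hom.hom.hom 1).hom) : ℚ) : ℂ)) := by
  intro c hc
  rw [trace_pullback_mul_self_eq φ hφ, trace_pullback_mul_self_eq χ hχ,
    trace_theta_mul_baseChange_pullback_eq hHD hI φ hd hφ hΘA,
    trace_theta_mul_baseChange_pullback_eq hHD hI χ hd' hχ hΘC, hC1] at hc
  -- the multiplicities of `χ` on `H^{1,0}(E)` are `(1,0)` or `(0,1)`
  have hsumC := eigenMultiplicity_add_eigenMultiplicity_neg_eq_dim C χ hd' hχ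
  rw [hC1] at hsumC
  set a := eigenMultiplicity A φ (Complex.I * (Real.sqrt d : ℂ)) with ha
  set b := eigenMultiplicity A φ (-(Complex.I * (Real.sqrt d : ℂ))) with hb
  set a' := eigenMultiplicity C χ (Complex.I * (Real.sqrt d' : ℂ)) with ha'
  set b' := eigenMultiplicity C χ (-(Complex.I * (Real.sqrt d' : ℂ))) with hb'
  -- `(a' - b')² = 1`
  have hs : ((a' : ℂ) - (b' : ℂ)) ^ 2 = 1 := by
    rcases Nat.eq_zero_or_pos a' with h0 | h0
    · have h1 : b' = 1 := by omega
      rw [h0, h1]; norm_num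
    · have h1 : a' = 1 := by omega
      have h2 : b' = 0 := by omega
      rw [h1, h2]; norm_num
  have hsd : ((Real.sqrt d : ℝ) : ℂ) ^ 2 = (d : ℂ) := by
    rw [← Complex.ofReal_pow, Real.sq_sqrt (Nat.cast_nonneg d), Complex.ofReal_natCast]
  have hsd' : ((Real.sqrt d' : ℝ) : ℂ) ^ 2 = (d' : ℂ) := by
    rw [← Complex.ofReal_pow, Real.sq_sqrt (Nat.cast_nonneg d'), Complex.ofReal_natCast]
  -- square the identity
  have hsq := congrArg (fun z : ℂ => z ^ 2) hc
  have e1 : (((-((d : ℚ) * (2 * ((A.dim : ℕ) : ℚ))) : ℚ) : ℂ) * (2 * (Complex.I * (Real.sqrt d' : ℂ)) *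
      ((a' : ℂ) - (b' : ℂ)))) ^ 2 =
      16 * (d : ℂ) ^ 2 * (A.dim : ℂ) ^ 2 * (Complex.I ^ 2 * ((Real.sqrt d' : ℝ) : ℂ) ^ 2) *
        ((a' : ℂ) - (b' : ℂ)) ^ 2 := by push_cast; ring
  have e2 : ((c : ℂ) * (2 * (Complex.I * (Real.sqrt d : ℂ)) * ((a : ℂ) - (b : ℂ)) *
      ((-((d' : ℚ) * (2 * ((1 : ℕ) : ℚ))) : ℚ) : ℂ))) ^ 2 =
      16 * (c : ℂ) ^ 2 * (Complex.I ^ 2 * ((Real.sqrt d : ℝ) : ℂ) ^ 2) * ((a : ℂ) - (b : ℂ)) ^ 2 * (d' : ℂ) ^ 2 := by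
    push_cast; ring
  rw [e1, e2, Complex.I_sq, hsd, hsd', hs] at hsq
  -- `d² (dim A)² d' = c² (a-b)² d d'²`, read in `ℚ`
  have hsqQ : ((d : ℚ) ^ 2 * (A.dim : ℚ) ^ 2 * d' : ℚ) = (c ^ 2 * ((a : ℚ) - (b : ℚ)) ^ 2 * d * d' ^ 2 : ℚ) := by
    have h : ((d : ℚ) ^ 2 * (A.dim : ℚ) ^ 2 * d' : ℂ) = (c ^ 2 * ((a : ℚ) - (b : ℚ)) ^ 2 * d * d' ^ 2 : ℂ) := by
      push_cast
      linear_combination (-1 / 16 : ℂ) * hsq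
    exact_mod_cast h
  have hdQ : (d : ℚ) ≠ 0 := by exact_mod_cast hd.ne'
  have hd'Q : (d' : ℚ) ≠ 0 := by exact_mod_cast hd'.ne'
  have hdim : (A.dim : ℚ) ≠ 0 := by exact_mod_cast hA0.ne'
  apply hfree (c * ((a : ℚ) - (b : ℚ)) / A.dim)
  have key : (d : ℚ) * (A.dim : ℚ) ^ 2 = (c * ((a : ℚ) - (b : ℚ))) ^ 2 * d' := by
    have h := hsqQ
    have h' : ((d : ℚ) * d') * ((d : ℚ) * (A.dim : ℚ) ^ 2) = ((d : ℚ) * d') * ((c * ((a : ℚ) - (b : ℚ))) ^ 2 * d') := by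
      linear_combination h
    exact mul_left_cancel₀ (mul_ne_zero hdQ hd'Q) h'
  field_simp
  linear_combination key

end Data

/-! ### §3 The invariance theorem for slots over `A × E` -/

section Invariance

variable {A C X : AbelianVariety ℂ} {n : ℕ} {g : Fin n → (X ⟶ A.prod C)}

/-- The two elements of `Fin 2`. [folklore] -/
private theorem fin2_eq_zero_or_one_rk (r : Fin 2) : r = 0 ∨ r = 1 := by
  fin_cases r <;> simp

open scoped Classical in
/-- **The INVARIANCE THEOREM for slots over `A × C`, `A` with imaginary quadratic `End⁰(A) = ℚ(φ)` (ANY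
multiplicities), `C` an elliptic curve with complex multiplication `χ² = -d'`, `d/d' ∉ (ℚ^×)²`
(Moonen–Zarhin 1999 Lemma (3.6) / Prop. (3.8), Lie step).** The tree's
`AVSlots.exists_coeff_eq_zero_off_balanced_of_prod_thetaTrace_cmType` (there: `Θ`-trace condition on `A`, i.e.
balanced multiplicities) with the `Θ`-trace condition REPLACED by the rational independence of the `Θ`-trace slopes
(`∀ q : ℚ, d ≠ q² d'`: «no embedding of `k = ℚ(√-d')` into the centre `ℚ(√-d)` of `End⁰(A)`»): there are Hodge-adapted
pair bases of `H¹(A) ⊗ ℂ` and `H¹(C) ⊗ ℂ` such that every rational `(p,p)`-class on `X` (slots `g` over `A × C`) has a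
letter expansion whose coefficient function VANISHES off the `A`-kind-balanced words — the tensor invariants of `X`
are invariants of `Θ_A ⊕ 0`. Proof = the tree's proof verbatim, the Lie step now
`wordDerAt_incl_theta_proj_eq_zero_of_rankOneCentre_times_cmCurve`, fed with §1–§2.
[cite: MoonenZarhin1999LowDim, §3 Lemma (3.6) and Prop. (3.8)] [cite: MoonenZarhin1999LowDim, §3 (3.1)]
[cite: Deligne1982HodgeCycles, I §3 Prop. 3.4 and Prop. 3.6] [cite: Lombardo2016, Lemma 3.4 (p. 1229)] -/
theorem AVSlots.exists_coeff_eq_zero_off_balanced_of_prod_quadraticEnd_cmCurve (hg : AVSlots (A.prod C) X g)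
    (hA0 : 0 < A.dim) (hA2 : Module.finrank ℚ A.endAlgebra = 2) (φA : A ⟶ A) {d : ℕ} (hd : 0 < d)
    (hφA : φA ≫ φA = -(d • 𝟙 A)) (hC1 : C.dim = 1) (χ : C ⟶ C) {d' : ℕ} (hd' : 0 < d') (hχ : χ ≫ χ = -(d' • 𝟙 C))
    (hfree : ∀ q : ℚ, (d : ℚ) ≠ q ^ 2 * d') :
    ∃ (hA : ℕ) (bA : Module.Basis (Fin hA × Fin 2) ℂ (ℂ ⊗[ℚ] bettiCohomology A.X 1))
      (h : ℕ) (cC : Module.Basis (Fin h × Fin 2) ℂ (ℂ ⊗[ℚ] bettiCohomology C.X 1)),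
      (∀ i, IsOfHodgeType A.dim A.X 1 1 0 (ofRatClassBaseChange (Motives.ComplexPoints A.X) 1 (bA (i, 0)))) ∧
      (∀ i, IsOfHodgeType A.dim A.X 1 0 1 (ofRatClassBaseChange (Motives.ComplexPoints A.X) 1 (bA (i, 1)))) ∧
      (∀ i, IsOfHodgeType C.dim C.X 1 1 0 (ofRatClassBaseChange (Motives.ComplexPoints C.X) 1 (cC (i, 0)))) ∧
      (∀ i, IsOfHodgeType C.dim C.X 1 0 1 (ofRatClassBaseChange (Motives.ComplexPoints C.X) 1 (cC (i, 1)))) ∧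
      ∀ {p : ℕ}, 0 < p → ∀ {c : complexBetti X.X (2 * p)}, IsRationalClass c →
        IsOfHodgeType X.dim X.X (2 * p) p p c →
        ∃ a : (Fin (2 * p) → (Fin n × (Fin hA ⊕ Fin h)) × Fin 2) → ℂ,
          wordEval (cupPowOneAlt ℂ (Motives.ComplexPoints X.X) (2 * p))
            (fun jr : (Fin n × (Fin hA ⊕ Fin h)) × Fin 2 => complexBetti.map (g jr.1.1).hom.hom.hom 1
              (Sum.elim
                (fun i => complexBetti.map (Motives.AbelianVariety.fst A C).hom.hom.hom 1
                  (ofRatClassBaseChange (Motives.ComplexPoints A.X) 1 (bA (i, jr.2))))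
                (fun i => complexBetti.map (Motives.AbelianVariety.snd A C).hom.hom.hom 1
                  (ofRatClassBaseChange (Motives.ComplexPoints C.X) 1 (cC (i, jr.2))))
                jr.1.2)) a = c ∧
          ∀ (U : Fin (2 * p) → Fin n × (Fin hA ⊕ Fin h)) (η : Fin (2 * p) → Fin 2),
            (∑ t, Sum.elim (fun _ : Fin hA => if η t = 0 then (1 : ℂ) else -1) (fun _ : Fin h => (0 : ℂ)) (U t).2) ≠ 0 →
            a (fun t => (U t, η t)) = 0 := by
  classical
  -- the setting
  have hHD : exists_isReal_hodgeModel := exists_isReal_hodgeModel_holds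
  have hI : hodgePQ_independent_of_hodgeModel := hodgePQ_independent_of_hodgeModel_holds
  haveI : HodgeTensorFacts.{0, 0} := hodgeTensorFacts_holds.{0, 0}
  have hXA : IsSmoothProjective A.dim A.X := AbelianVariety.isSmoothProjective_holds
  have hXC : IsSmoothProjective C.dim C.X := AbelianVariety.isSmoothProjective_holds
  have hXP : IsSmoothProjective (A.prod C).dim (A.prod C).X := AbelianVariety.isSmoothProjective_holds
  haveI : Module.Finite ℚ (bettiCohomology A.X 1) := finite_bettiCohomology_one A
  haveI : Module.Finite ℚ (bettiCohomology C.X 1) := finite_bettiCohomology_one C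
  haveI : Module.Finite ℚ (bettiCohomology (A.prod C).X 1) := finite_bettiCohomology_one (A.prod C)
  have hn1 : (((1 : ℕ) : ℤ)) = 1 := by norm_num
  -- the pair bases of `H¹(A) ⊗ ℂ` and `H¹(C) ⊗ ℂ`
  obtain ⟨hA, bA, hbA0, hbA1⟩ := exists_hodgeAdapted_pairBasis (BettiUniverse.hodge hHD hXA 1) (by norm_num)
    (BettiUniverse.hodge_isEffective hHD hXA 1)
  have hbA0' : ∀ i, bA (i, 0) ∈ (BettiUniverse.hodge hHD hXA 1).piece 1 0 := fun i => by simpa using hbA0 i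
  have hbA1' : ∀ i, bA (i, 1) ∈ (BettiUniverse.hodge hHD hXA 1).piece 0 1 := fun i => by simpa using hbA1 i
  obtain ⟨h, cC, hcC0, hcC1⟩ := exists_hodgeAdapted_pairBasis (BettiUniverse.hodge hHD hXC 1) (by norm_num)
    (BettiUniverse.hodge_isEffective hHD hXC 1)
  have hcC0' : ∀ i, cC (i, 0) ∈ (BettiUniverse.hodge hHD hXC 1).piece 1 0 := fun i => by simpa using hcC0 i
  have hcC1' : ∀ i, cC (i, 1) ∈ (BettiUniverse.hodge hHD hXC 1).piece 0 1 := fun i => by simpa using hcC1 i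
  refine ⟨hA, bA, h, cC, fun i => ?_, fun i => ?_, fun i => ?_, fun i => ?_, ?_⟩
  · exact (BettiUniverse.mem_hodge_piece_iff hHD hI hXA (k := 1) (p := 1) (q := 0) rfl _).1 (hbA0' i)
  · exact (BettiUniverse.mem_hodge_piece_iff hHD hI hXA (k := 1) (p := 0) (q := 1) rfl _).1 (hbA1' i)
  · exact (BettiUniverse.mem_hodge_piece_iff hHD hI hXC (k := 1) (p := 1) (q := 0) rfl _).1 (hcC0' i)
  · exact (BettiUniverse.mem_hodge_piece_iff hHD hI hXC (k := 1) (p := 0) (q := 1) rfl _).1 (hcC1' i)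
  intro p hp c hcQ hc
  -- the presentation `H¹(A × C) = pr_A^* H¹(A) ⊕ pr_C^* H¹(C)` and its complexification
  set ι₁ := HOneProduct.pullFst A C with hι₁
  set π₁ := HOneProduct.pullInl A C with hπ₁
  set ι₂ := HOneProduct.pullSnd A C with hι₂
  set π₂ := HOneProduct.pullInr A C with hπ₂
  have hπι₁ : π₁ ∘ₗ ι₁ = LinearMap.id := HOneProduct.pullInl_comp_pullFst
  have hπι₂ : π₂ ∘ₗ ι₂ = LinearMap.id := HOneProduct.pullInr_comp_pullSnd
  have hπ₁ι₂ : π₁ ∘ₗ ι₂ = 0 := HOneProduct.pullInl_comp_pullSnd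
  have hπ₂ι₁ : π₂ ∘ₗ ι₁ = 0 := HOneProduct.pullInr_comp_pullFst
  have hsum : ι₁ ∘ₗ π₁ + ι₂ ∘ₗ π₂ = LinearMap.id := HOneProduct.pullFst_comp_pullInl_add
  have hπι₁C : π₁.baseChange ℂ ∘ₗ ι₁.baseChange ℂ = LinearMap.id := by
    rw [← LinearMap.baseChange_comp, hπι₁, LinearMap.baseChange_id]
  have hπι₂C : π₂.baseChange ℂ ∘ₗ ι₂.baseChange ℂ = LinearMap.id := by
    rw [← LinearMap.baseChange_comp, hπι₂, LinearMap.baseChange_id]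
  have hπ₁ι₂C : π₁.baseChange ℂ ∘ₗ ι₂.baseChange ℂ = 0 := by
    rw [← LinearMap.baseChange_comp, hπ₁ι₂, LinearMap.baseChange_zero]
  have hπ₂ι₁C : π₂.baseChange ℂ ∘ₗ ι₁.baseChange ℂ = 0 := by
    rw [← LinearMap.baseChange_comp, hπ₂ι₁, LinearMap.baseChange_zero]
  have hsumC : ι₁.baseChange ℂ ∘ₗ π₁.baseChange ℂ + ι₂.baseChange ℂ ∘ₗ π₂.baseChange ℂ = LinearMap.id := by
    rw [← LinearMap.baseChange_comp, ← LinearMap.baseChange_comp, ← LinearMap.baseChange_add, hsum,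
      LinearMap.baseChange_id]
  -- piece compatibility of `pr_A^*`, `pr_C^*` (pull-backs are morphisms of Hodge structures)
  have hι₁F : ∀ q : ℤ, ∀ x ∈ (BettiUniverse.hodge hHD hXA 1).piece q (((1 : ℕ) : ℤ) - q), ι₁.baseChange ℂ x ∈ (BettiUniverse.hodge hHD hXP 1).piece q (((1 : ℕ) : ℤ) - q) :=
    fun q x hx => (BettiUniverse.pullHodgeHom hHD hI hXP hXA (Motives.AbelianVariety.fst A C).hom.hom.hom 1).map_piece_le
      q _ ⟨x, hx, rfl⟩
  have hι₂F : ∀ q : ℤ, ∀ x ∈ (BettiUniverse.hodge hHD hXC 1).piece q (((1 : ℕ) : ℤ) - q), ι₂.baseChange ℂ x ∈ (BettiUniverse.hodge hHD hXP 1).piece q (((1 : ℕ) : ℤ) - q) :=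
    fun q x hx => (BettiUniverse.pullHodgeHom hHD hI hXP hXC (Motives.AbelianVariety.snd A C).hom.hom.hom 1).map_piece_le
      q _ ⟨x, hx, rfl⟩
  -- §1: the basis `cbx` of `H¹(A × C) ⊗ ℂ` in pairs: `pr_A^* b_i^r` and `pr_C^* c_i^r`
  obtain ⟨cbx', hcbx'l, hcbx'r⟩ := exists_basis_of_presentation hπι₁C hπι₂C hπ₁ι₂C hπ₂ι₁C hsumC bA cC
  set cbx : Module.Basis ((Fin hA ⊕ Fin h) × Fin 2) ℂ (ℂ ⊗[ℚ] bettiCohomology (A.prod C).X 1) :=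
    cbx'.reindex (Equiv.sumProdDistrib (Fin hA) (Fin h) (Fin 2)).symm with hcbxdef
  have hcbx : ∀ tr : (Fin hA ⊕ Fin h) × Fin 2, cbx tr =
      Sum.elim (fun i => ι₁.baseChange ℂ (bA (i, tr.2))) (fun i => ι₂.baseChange ℂ (cC (i, tr.2))) tr.1 := by
    rintro ⟨t, r⟩
    rw [hcbxdef, Module.Basis.reindex_apply, Equiv.symm_symm]
    rcases t with i | i
    · rw [Equiv.sumProdDistrib_apply_left, hcbx'l]; rfl
    · rw [Equiv.sumProdDistrib_apply_right, hcbx'r]; rfl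
  -- Hodge-adaptedness of `cbx`
  have hcbx0 : ∀ t, cbx (t, 0) ∈ (BettiUniverse.hodge hHD hXP 1).piece 1 0 := by
    intro t
    rw [hcbx]
    rcases t with i | i
    · exact hι₁F 1 _ (by simpa using hbA0' i)
    · exact hι₂F 1 _ (by simpa using hcC0' i)
  have hcbx1 : ∀ t, cbx (t, 1) ∈ (BettiUniverse.hodge hHD hXP 1).piece 0 1 := by
    intro t
    rw [hcbx]
    rcases t with i | i
    · have e : (((1 : ℕ) : ℤ) - 0) = 1 := by norm_num
      have h01 := hι₁F 0 _ (by rw [e]; exact hbA1' i)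
      rwa [e] at h01
    · have e : (((1 : ℕ) : ℤ) - 0) = 1 := by norm_num
      have h01 := hι₂F 0 _ (by rw [e]; exact hcC1' i)
      rwa [e] at h01
  -- bases indexed by `Fin M`: the pair basis `cbσ` and the rational basis `eC`
  set eQ := Module.finBasis ℚ (bettiCohomology (A.prod C).X 1) with heQ
  set eC : Module.Basis (Fin (Module.finrank ℚ (bettiCohomology (A.prod C).X 1))) ℂ
    (ℂ ⊗[ℚ] bettiCohomology (A.prod C).X 1) := Algebra.TensorProduct.basis ℂ eQ with heC
  set φ : Fin (Module.finrank ℚ (bettiCohomology (A.prod C).X 1)) ≃ (Fin hA ⊕ Fin h) × Fin 2 :=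
    eC.indexEquiv cbx with hφ
  set cbσ : Module.Basis (Fin (Module.finrank ℚ (bettiCohomology (A.prod C).X 1))) ℂ
    (ℂ ⊗[ℚ] bettiCohomology (A.prod C).X 1) := cbx.reindex φ.symm with hcbσdef
  have hcbσ : ∀ m, cbσ m = cbx (φ m) := fun m => by
    rw [hcbσdef, Module.Basis.reindex_apply, Equiv.symm_symm]
  -- letters
  set ρ := ofRatClassBaseChangeEquiv hXP 1 with hρ
  set v : Module.Basis _ ℂ (complexBetti (A.prod C).X 1) := cbσ.map ρ with hv
  set eL : Module.Basis _ ℂ (complexBetti (A.prod C).X 1) := eC.map ρ with heL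
  have heLQ : ∀ i, IsRationalClass (eL i) := fun i => by
    rw [heL, Module.Basis.map_apply, heC, Algebra.TensorProduct.basis_apply, hρ,
      ofRatClassBaseChangeEquiv_apply, ofRatClassBaseChange_tmul, one_smul]
    exact isRationalClass_ofRatClass _
  set κ : Fin (Module.finrank ℚ (bettiCohomology (A.prod C).X 1)) → Fin 2 := fun m => (φ m).2 with hκ
  have hv_apply : ∀ m, v m = ofRatClassBaseChange (Motives.ComplexPoints (A.prod C).X) 1 (cbx (φ m)) := fun m => by
    rw [hv, Module.Basis.map_apply, hcbσ, hρ, ofRatClassBaseChangeEquiv_apply]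
  have hv0 : ∀ m, κ m = 0 → IsOfHodgeType (A.prod C).dim (A.prod C).X 1 1 0 (v m) := by
    intro m hm
    rw [hv_apply, ← BettiUniverse.mem_hodge_piece_iff hHD hI hXP (k := 1) (p := 1) (q := 0) rfl]
    have hsplit : φ m = ((φ m).1, 0) := by
      change (φ m).2 = 0 at hm; rw [← hm]
    rw [hsplit]
    exact hcbx0 _
  have hv1 : ∀ m, κ m = 1 → IsOfHodgeType (A.prod C).dim (A.prod C).X 1 0 1 (v m) := by
    intro m hm
    rw [hv_apply, ← BettiUniverse.mem_hodge_piece_iff hHD hI hXP (k := 1) (p := 0) (q := 1) rfl]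
    have hsplit : φ m = ((φ m).1, 1) := by
      change (φ m).2 = 1 at hm; rw [← hm]
    rw [hsplit]
    exact hcbx1 _
  -- (α) an antisymmetric kind-balanced coefficient function in the adapted letters
  obtain ⟨ax, hax_bal, hax_anti, hcax⟩ := hg.exists_antisymm_kindBalanced_wordEval_eq v κ hv0 hv1 hp hc
  -- the change of letters to the rational letters
  set G : Matrix _ _ ℂ := eC.toMatrix cbσ with hG
  set G' : Matrix _ _ ℂ := cbσ.toMatrix eC with hG'
  have hG'G : G' * G = 1 := cbσ.toMatrix_mul_toMatrix_flip eC
  have hve : ∀ m, v m = ∑ i, G i m • eL i := fun m => by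
    simp only [hv, heL, Module.Basis.map_apply, ← map_smul, ← map_sum]
    congr 1
    exact (eC.sum_toMatrix_smul_self (v := ⇑cbσ) (j := m)).symm
  have hletters : ∀ j m, avLetters g v (j, m) = ∑ i, G i m • avLetters g eL (j, i) :=
    avLetters_baseChange g G hve
  set aE := colourChangeAt (fun _ : Fin n => G) ax with haE
  have haE_anti : IsAntisymm aE := hax_anti.colourChangeAt _
  have hcaE : wordEval (cupPowOneAlt ℂ (Motives.ComplexPoints X.X) (2 * p)) (avLetters g eL) aE = c := by
    rw [haE, ← wordEval_eq_wordEval_colourChangeAt _ (fun _ : Fin n => G) hletters ax, hcax]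
  -- rationality of `aE`
  have hFinj : Function.Injective (exteriorPower.alternatingMapLinearEquiv
      (cupPowOneAlt ℂ (Motives.ComplexPoints X.X) (2 * p))) :=
    injective_alternatingMapLinearEquiv_cupPowOneAlt X (2 * p)
  obtain ⟨q, hq⟩ := hg.exists_rat_wordEval_eq eL heLQ hcQ
  obtain ⟨q', -, haEq⟩ := haE_anti.exists_eq_algebraMap_of_wordEval_eq hFinj (hg.letterBasis eL)
    (q := q) (by rw [AVSlots.coe_letterBasis, hcaE, hq])
  have hslice_e : ∀ u, wordSlice aE u = wordRepAt ℂ (fun _ : Fin (2 * p) => G) (wordSlice ax u) :=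
    fun u => wordSlice_colourChangeAt (fun _ : Fin n => G) ax u
  -- the Hodge operator `Θ` of `H¹(A × C)`: `diag(±1)` in the adapted letters
  obtain ⟨Θ, hΘ⟩ := exists_hodgeTheta (BettiUniverse.hodge hHD hXP 1)
  have hΘb : ∀ m, Θ (cbσ m) = (if κ m = 0 then (1 : ℂ) else -1) • cbσ m := by
    intro m
    rw [hcbσ]
    change Θ _ = (if (φ m).2 = 0 then (1 : ℂ) else -1) • _
    rcases fin2_eq_zero_or_one_rk (φ m).2 with h0 | h1
    · rw [h0, if_pos rfl]
      have hmem : cbx (φ m) ∈ (BettiUniverse.hodge hHD hXP 1).piece 1 (((1 : ℕ) : ℤ) - 1) := by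
        have e : (((1 : ℕ) : ℤ) - 1) = 0 := by norm_num
        have hsplit : φ m = ((φ m).1, 0) := by rw [← h0]
        rw [e, hsplit]; exact hcbx0 _
      rw [hΘ 1 _ hmem]
      norm_num
    · rw [h1, if_neg one_ne_zero]
      have hmem : cbx (φ m) ∈ (BettiUniverse.hodge hHD hXP 1).piece 0 (((1 : ℕ) : ℤ) - 0) := by
        have e : (((1 : ℕ) : ℤ) - 0) = 1 := by norm_num
        have hsplit : φ m = ((φ m).1, 1) := by rw [← h1]
        rw [e, hsplit]; exact hcbx1 _
      rw [hΘ 0 _ hmem]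
      norm_num
  have hΘcb : LinearMap.toMatrix cbσ cbσ Θ = kindDiag κ := by
    ext i m
    rw [LinearMap.toMatrix_apply, hΘb, map_smul, Module.Basis.repr_self, Finsupp.smul_apply,
      Finsupp.single_apply, kindDiag, Matrix.diagonal_apply, smul_eq_mul, mul_ite, mul_one, mul_zero]
    by_cases him : i = m
    · subst him; rw [if_pos rfl]
    · rw [if_neg (Ne.symm him), if_neg him]
  have hJG : LinearMap.toMatrix eC eC Θ * G = G * kindDiag κ := by
    rw [← hΘcb, hG, linearMap_toMatrix_mul_basis_toMatrix, basis_toMatrix_mul_linearMap_toMatrix]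
  have hΘq : ∀ u : Fin (2 * p) → Fin n, wordDerAt ℂ (fun _ : Fin (2 * p) => LinearMap.toMatrix eC eC Θ)
      (wordSlice (fun w => algebraMap ℚ ℂ (q' w)) u) = 0 := by
    intro u
    rw [← haEq, hslice_e]
    refine wordDerAt_wordRepAt_eq_zero_of_mul_eq ℂ (fun _ : Fin (2 * p) => G) (fun _ => hJG) ?_
    rw [wordDerAt_const]
    exact wordDer_kindDiag_wordSlice_eq_zero κ hax_bal u
  -- polarizations of `H¹(A)`, `H¹(C)`
  obtain ⟨ψ⟩ : (BettiUniverse.hodge hHD (AbelianVariety.isSmoothProjective_holds (A := A)) 1).IsPolarizable :=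
    smoothProjective_hodgeStructure_isPolarizable_holds hXA (BettiUniverse.realHodgeModel hHD hXA)
      (BettiUniverse.realHodgeModel_isHodgeSymmetric hHD hXA) 1
  obtain ⟨ψC⟩ : (BettiUniverse.hodge hHD (AbelianVariety.isSmoothProjective_holds (A := C)) 1).IsPolarizable :=
    smoothProjective_hodgeStructure_isPolarizable_holds hXC (BettiUniverse.realHodgeModel hHD hXC)
      (BettiUniverse.realHodgeModel_isHodgeSymmetric hHD hXC) 1
  -- the Hodge operators `Θ_A`, `Θ_C` and the partial Hodge operator `Y = pr_A^* ∘ Θ_A ∘ ι_A^*`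
  obtain ⟨ΘA, hΘA⟩ := exists_hodgeTheta (BettiUniverse.hodge hHD hXA 1)
  obtain ⟨ΘC, hΘC⟩ := exists_hodgeTheta (BettiUniverse.hodge hHD hXC 1)
  set Y := ι₁.baseChange ℂ ∘ₗ ΘA ∘ₗ π₁.baseChange ℂ with hY
  -- the rational data `φ^*`, `χ^*` (§2) and the rational independence of the `Θ`-trace slopes
  obtain ⟨hφE, -, hZ⟩ := quadraticEnd_skewCentre_data hHD hI hA0 hA2 hd hφA ψ
  have hχE := pullback_mem_endAlg hHD hI χ
  have hχ2 : (bettiCohomology.map χ.hom.hom.hom 1).hom * (bettiCohomology.map χ.hom.hom.hom 1).hom =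
      -((d' : ℚ) • 1) := bettiMapHom_mul_self hχ
  have hd'Q : (0 : ℚ) < d' := Nat.cast_pos.2 hd'
  have hV₂ : Module.finrank ℚ (bettiCohomology C.X 1) = 2 := by rw [finrank_bettiCohomology_one C, hC1]
  have hres := traceSlopes_ne_of_forall_ne_sq_mul hHD hI hA0 hd hφA hC1 hd' hχ hfree hΘA hΘC
  -- the product Lie step: `Y` kills the rational coefficient tensor
  have hL : ∀ u : Fin (2 * p) → Fin n, wordDerAt ℂ (fun _ : Fin (2 * p) => LinearMap.toMatrix eC eC Y)
      (wordSlice (fun w => algebraMap ℚ ℂ (q' w)) u) = 0 := fun u =>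
    wordDerAt_incl_theta_proj_eq_zero_of_rankOneCentre_times_cmCurve hn1 (BettiUniverse.hodge hHD hXP 1)
      (BettiUniverse.hodge hHD hXA 1) (BettiUniverse.hodge hHD hXC 1) (BettiUniverse.hodge_isEffective hHD hXA 1)
      (BettiUniverse.hodge_isEffective hHD hXC 1) hπι₁ hπι₂ hπ₁ι₂ hπ₂ι₁ hsum hι₁F hι₂F ψ ψC hφE hZ hχE hd'Q hχ2 hV₂
      eQ q' hΘ hΘA hΘC hres hΘq u
  -- the diagonal weights of `Y` in the pair letters: `±1` at the `A`-places, `0` at the `C`-places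
  set δ₀ : Fin hA ⊕ Fin h → Fin 2 → ℂ :=
    Sum.elim (fun (_ : Fin hA) (r : Fin 2) => if r = 0 then (1 : ℂ) else -1) (fun (_ : Fin h) (_ : Fin 2) => (0 : ℂ))
    with hδ₀
  set D : Fin hA ⊕ Fin h → Matrix (Fin 2) (Fin 2) ℂ := fun t => Matrix.diagonal (δ₀ t) with hD
  have hYG : ∀ _t : Fin (2 * p), LinearMap.toMatrix eC eC Y * G = G * LinearMap.toMatrix cbσ cbσ Y :=
    fun _ => by rw [hG, linearMap_toMatrix_mul_basis_toMatrix, basis_toMatrix_mul_linearMap_toMatrix]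
  have e11 : ∀ x, π₁.baseChange ℂ (ι₁.baseChange ℂ x) = x := fun x => by
    rw [← LinearMap.comp_apply (f := π₁.baseChange ℂ), hπι₁C, LinearMap.id_apply]
  have e12 : ∀ y, π₁.baseChange ℂ (ι₂.baseChange ℂ y) = 0 := fun y => by
    rw [← LinearMap.comp_apply (f := π₁.baseChange ℂ), hπ₁ι₂C, LinearMap.zero_apply]
  -- `Θ_A` on the pair basis of `H¹(A) ⊗ ℂ`
  have hΘAb : ∀ (i : Fin hA) (r : Fin 2), ΘA (bA (i, r)) = (if r = 0 then (1 : ℂ) else -1) • bA (i, r) := by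
    intro i r
    rcases fin2_eq_zero_or_one_rk r with h0 | h1
    · rw [h0, if_pos rfl]
      have hmem : bA (i, 0) ∈ (BettiUniverse.hodge hHD hXA 1).piece 1 (((1 : ℕ) : ℤ) - 1) := by
        have e : (((1 : ℕ) : ℤ) - 1) = 0 := by norm_num
        rw [e]; exact hbA0' i
      rw [hΘA 1 _ hmem]
      norm_num
    · rw [h1, if_neg one_ne_zero]
      have hmem : bA (i, 1) ∈ (BettiUniverse.hodge hHD hXA 1).piece 0 (((1 : ℕ) : ℤ) - 0) := by
        have e : (((1 : ℕ) : ℤ) - 0) = 1 := by norm_num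
        rw [e]; exact hbA1' i
      rw [hΘA 0 _ hmem]
      norm_num
  have hblk : LinearMap.toMatrix cbσ cbσ Y = blockLift φ D := by
    refine toMatrix_eq_blockLift_of_apply_basis φ cbσ _ Y fun m => ?_
    rw [hcbσ m]
    have hb' : ∀ a, cbσ (φ.symm ((φ m).1, a)) = cbx ((φ m).1, a) := fun a => by
      rw [hcbσ, Equiv.apply_symm_apply]
    simp only [hb']
    obtain ⟨t, r⟩ := φ m
    rcases t with i | i
    · simp only [hcbx, Sum.elim_inl]
      rw [hY, LinearMap.comp_apply, LinearMap.comp_apply, e11, hΘAb, map_smul,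
        Finset.sum_eq_single r]
      · rw [hD]
        simp only [hδ₀, Sum.elim_inl, Matrix.diagonal_apply_eq]
      · intro a _ ha
        rw [hD]
        simp only [Matrix.diagonal_apply_ne _ ha, zero_smul]
      · intro hr; exact absurd (Finset.mem_univ r) hr
    · simp only [hcbx, Sum.elim_inr]
      rw [hY, LinearMap.comp_apply, LinearMap.comp_apply, e12, map_zero, map_zero]
      symm
      refine Finset.sum_eq_zero fun a _ => ?_
      have h0 : D (Sum.inr i) a r = 0 := by
        simp [hD, hδ₀, Matrix.diagonal_apply]
      rw [h0, zero_smul]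
  -- `Y` kills the coefficient tensor in the pair letters
  have hax : ∀ u : Fin (2 * p) → Fin n, wordDerAt ℂ (fun _ : Fin (2 * p) => blockLift φ D) (wordSlice ax u) = 0 := by
    intro u
    have hLu := hL u
    rw [← haEq, hslice_e] at hLu
    have h3 : wordRepAt ℂ (fun _ : Fin (2 * p) => G)
        (wordDerAt ℂ (fun _ : Fin (2 * p) => blockLift φ D) (wordSlice ax u)) = 0 := by
      rw [← hblk, wordRepAt_wordDerAt_of_mul_eq ℂ (fun _ : Fin (2 * p) => G) hYG, hLu]
    exact wordRepAt_injective ℂ (g := fun _ : Fin (2 * p) => G) (g' := fun _ : Fin (2 * p) => G')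
      (funext fun _ => hG'G) (by rw [h3, map_zero])
  -- the coefficient function, refined to slot-and-place colours
  refine ⟨placeRefine φ ax, ?_, fun U η hU => ?_⟩
  · rw [← hcax]
    have hx : (fun jr : (Fin n × (Fin hA ⊕ Fin h)) × Fin 2 => avLetters g v (jr.1.1, φ.symm (jr.1.2, jr.2))) =
        fun jr : (Fin n × (Fin hA ⊕ Fin h)) × Fin 2 => complexBetti.map (g jr.1.1).hom.hom.hom 1
          (Sum.elim
            (fun i => complexBetti.map (Motives.AbelianVariety.fst A C).hom.hom.hom 1
              (ofRatClassBaseChange (Motives.ComplexPoints A.X) 1 (bA (i, jr.2))))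
            (fun i => complexBetti.map (Motives.AbelianVariety.snd A C).hom.hom.hom 1
              (ofRatClassBaseChange (Motives.ComplexPoints C.X) 1 (cC (i, jr.2))))
            jr.1.2) := by
      funext jr
      rw [avLetters_apply, hv_apply, Equiv.apply_symm_apply, hcbx]
      obtain ⟨⟨j, t⟩, r⟩ := jr
      rcases t with i | i
      · simp only [Sum.elim_inl]
        congr 1
        rw [hι₁, ← ofRatClassBaseChangeEquiv_apply (hX := hXP), ← ofRatClassBaseChangeEquiv_apply (hX := hXA),
          complexBetti_map_ofRatClassBaseChangeEquiv hXP hXA]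
      · simp only [Sum.elim_inr]
        congr 1
        rw [hι₂, ← ofRatClassBaseChangeEquiv_apply (hX := hXP), ← ofRatClassBaseChangeEquiv_apply (hX := hXC),
          complexBetti_map_ofRatClassBaseChangeEquiv hXP hXC]
    rw [← hx]
    exact wordEval_placeRefine _ φ (avLetters g v) ax
  · -- the blocks of `Y` placed by place kill the refined slices; read off the diagonal weights
    have h1 := wordDerAt_placeFamily_placeRefine_eq_zero φ D hax U
    have h2 : wordDerAt ℂ (fun t => Matrix.diagonal (δ₀ (U t).2)) (wordSlice (placeRefine φ ax) U) = 0 := h1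
    have h3 := eq_zero_of_wordDerAt_diagonal_eq_zero (fun t => δ₀ (U t).2) h2 η (by
      have hsum_eq : ∑ t, δ₀ (U t).2 (η t) =
          ∑ t, Sum.elim (fun _ : Fin hA => if η t = 0 then (1 : ℂ) else -1) (fun _ : Fin h => (0 : ℂ)) (U t).2 := by
        refine Finset.sum_congr rfl fun t _ => ?_
        rw [hδ₀]
        exact sum_elim_kindWeight_apply (U t).2 (η t)
      rw [hsum_eq]; exact hU)
    rw [wordSlice_apply] at h3
    exact h3


end Invariance

end Literature.AlgebraicGeometry.HodgeTheory

end
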